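import Literature.MathematicalPhysics.StatisticalMechanics.HardDiscStarTies
import HarnessLib

/-!
# The complete-star Mayer diagram of hard discs, II: slices of the longest-edge piece

Third file towards the discharge of
`Literature.MathematicalPhysics.StatisticalMechanics.HardSphereVirial.hardDisc_B4`
([ClisbyMccoy2004, §1]). With `star`, `P₁` as in `HardDiscStarSymmetry.lean` /
`HardDiscStarTies.lean` (`vol(star) = 6 · vol(P₁)`, `P₁` = configurations `(x, y, z)` of the
complete star on which `|x|` is the longest of the six distances) we prove

  `volume_starDisc_eq : vol(starDisc) = 2π · vol(Wset)`,

`Wset = {(u, v) ∈ V × V : |u − v| < 1}`, `V = B(0,1) ∩ B((0,1),1)` the standard lens at distance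
`1` (a 4-dimensional set whose volume, `π²/2 − (3√3/4)π + 1/2`, is computed in
`HardDiscStarLens.lean`).

## Proof

* For fixed `x` with `|x|² = s ∈ (0,1)` the slice of `P₁` is
  `{(y,z) : |y|², |z|², |y−x|², |z−x|², |y−z|² < s}`, the preimage of `Wset` under the linear
  similarity `ψ_x ⊕ ψ_x`, `ψ_x(y) = ((x₂y₁ − x₁y₂)/s, (x₁y₁ + x₂y₂)/s)` (ratio `1/√s`,
  `ψ_x(x) = (0,1)`), hence of volume `s² · vol(Wset)` (`Measure.addHaar_preimage_linearEquiv`; the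
  constant `s²` is read off from the unit discs via `Measure.addHaar_smul`).
* Tonelli and polar coordinates (`HardDiscRingVolume.lintegral_radial_ite`):
  `vol(P₁) = vol(Wset) · ∫_{|x|<1} |x|⁴ dx = vol(Wset) · π/3`, so `vol(star) = 2π · vol(Wset)`.
* `starDisc ⊆ Fin 6 → ℝ` is the preimage of `star` under the measure-preserving coordinate map of
  `HardDiscRingVolume.measurePreserving_toFin6` (with `x₃` in the role of the distinguished point).

All auxiliary results are [folklore]; sub-namespace `HardDiscStarVolume`. No definitions and no
named facts are introduced (sets written out in full, as in part I).

## References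

* [ClisbyMccoy2004] N. Clisby, B. M. McCoy, J. Stat. Phys. 114 (2004) 1343–1361, §§1–2.
-/

noncomputable section

open _root_.MeasureTheory _root_.Set _root_.Real intervalIntegral

namespace Literature.MathematicalPhysics.StatisticalMechanics

namespace HardDiscStarVolume

open HardDiscTriangleVolume HardDiscRingVolume

open scoped Pointwise

/-! ### The slices of `P₁`: similar copies of `Wset` -/

/-- `Wset` is measurable. [folklore] -/
theorem measurableSet_wset : MeasurableSet
    {w : (ℝ × ℝ) × (ℝ × ℝ) |
      w.1.1 ^ (2:ℕ) + w.1.2 ^ (2:ℕ) < 1 ∧ w.1.1 ^ (2:ℕ) + (w.1.2 - 1) ^ (2:ℕ) < 1 ∧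
      w.2.1 ^ (2:ℕ) + w.2.2 ^ (2:ℕ) < 1 ∧ w.2.1 ^ (2:ℕ) + (w.2.2 - 1) ^ (2:ℕ) < 1 ∧
      (w.1.1 - w.2.1) ^ (2:ℕ) + (w.1.2 - w.2.2) ^ (2:ℕ) < 1} := by
  simp only [setOf_and]
  refine MeasurableSet.inter ?_ (MeasurableSet.inter ?_ (MeasurableSet.inter ?_
    (MeasurableSet.inter ?_ ?_))) <;>
    exact measurableSet_lt (by fun_prop) (by fun_prop)

/-- Scaling a Euclidean disc of `ℝ × ℝ`: `vol{|y|² < s} = s · vol{|y|² < 1}` for `s > 0`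
(`Measure.addHaar_smul` with the factor `√s`). [folklore] -/
theorem volume_disc_sq_lt {s : ℝ} (hs : 0 < s) :
    volume {y : ℝ × ℝ | y.1 ^ 2 + y.2 ^ 2 < s} =
      ENNReal.ofReal s * volume {y : ℝ × ℝ | y.1 ^ 2 + y.2 ^ 2 < 1} := by
  have hr : 0 < √s := sqrt_pos.mpr hs
  have hrs : √s ^ 2 = s := sq_sqrt hs.le
  have hset : {y : ℝ × ℝ | y.1 ^ 2 + y.2 ^ 2 < s} = √s • {y : ℝ × ℝ | y.1 ^ 2 + y.2 ^ 2 < 1} := by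
    ext y
    rw [Set.mem_smul_set]
    constructor
    · intro hy
      refine ⟨(√s)⁻¹ • y, ?_, ?_⟩
      · simp only [mem_setOf_eq, Prod.smul_fst, Prod.smul_snd, smul_eq_mul] at hy ⊢
        rw [show ((√s)⁻¹ * y.1) ^ 2 + ((√s)⁻¹ * y.2) ^ 2 = (y.1 ^ 2 + y.2 ^ 2) / s by
          rw [mul_pow, mul_pow, inv_pow, hrs]; ring]
        rwa [div_lt_one hs]
      · rw [smul_smul, mul_inv_cancel₀ hr.ne', one_smul]
    · rintro ⟨q, hq, rfl⟩
      simp only [mem_setOf_eq, Prod.smul_fst, Prod.smul_snd, smul_eq_mul] at hq ⊢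
      nlinarith [hrs]
  have habs : |√s ^ Module.finrank ℝ (ℝ × ℝ)| = s := by
    rw [Module.finrank_prod, Module.finrank_self, abs_of_nonneg (by positivity),
      show (1 + 1 : ℕ) = 2 from rfl, hrs]
  rw [hset, Measure.addHaar_smul, habs]

/-- The `x`-slice of `P₁` for `x ≠ 0`: with `s = |x|²`, the set
`{(y,z) : |y|², |z|², |x−y|², |x−z|², |y−z|² < s}` is the preimage of `Wset` under the linear
similarity `ψ_x ⊕ ψ_x`, `ψ_x(y) = ((x₂y₁ − x₁y₂)/s, (x₁y₁ + x₂y₂)/s)` (ratio `1/√s`,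
`ψ_x(x) = (0,1)`), so its volume is `s² · vol(Wset)`. [folklore] -/
theorem volume_slice_pos (x : ℝ × ℝ) (hx : 0 < x.1 ^ 2 + x.2 ^ 2) :
    volume {w : (ℝ × ℝ) × (ℝ × ℝ) | w.1.1 ^ 2 + w.1.2 ^ 2 < x.1 ^ 2 + x.2 ^ 2 ∧
        w.2.1 ^ 2 + w.2.2 ^ 2 < x.1 ^ 2 + x.2 ^ 2 ∧
        (x.1 - w.1.1) ^ 2 + (x.2 - w.1.2) ^ 2 < x.1 ^ 2 + x.2 ^ 2 ∧
        (x.1 - w.2.1) ^ 2 + (x.2 - w.2.2) ^ 2 < x.1 ^ 2 + x.2 ^ 2 ∧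
        (w.1.1 - w.2.1) ^ 2 + (w.1.2 - w.2.2) ^ 2 < x.1 ^ 2 + x.2 ^ 2} =
      ENNReal.ofReal ((x.1 ^ 2 + x.2 ^ 2) ^ 2) * volume
    {w : (ℝ × ℝ) × (ℝ × ℝ) |
      w.1.1 ^ (2:ℕ) + w.1.2 ^ (2:ℕ) < 1 ∧ w.1.1 ^ (2:ℕ) + (w.1.2 - 1) ^ (2:ℕ) < 1 ∧
      w.2.1 ^ (2:ℕ) + w.2.2 ^ (2:ℕ) < 1 ∧ w.2.1 ^ (2:ℕ) + (w.2.2 - 1) ^ (2:ℕ) < 1 ∧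
      (w.1.1 - w.2.1) ^ (2:ℕ) + (w.1.2 - w.2.2) ^ (2:ℕ) < 1} := by
  haveI : Measure.IsAddHaarMeasure (volume : Measure ((ℝ × ℝ) × (ℝ × ℝ))) :=
    Measure.prod.instIsAddHaarMeasure _ _
  set a := x.1 with ha
  set b := x.2 with hb
  set s := a ^ 2 + b ^ 2 with hs_def
  have hs : s ≠ 0 := hx.ne'
  let Ψ : ((ℝ × ℝ) × (ℝ × ℝ)) ≃ₗ[ℝ] ((ℝ × ℝ) × (ℝ × ℝ)) :=
    { toFun := fun w => (((b * w.1.1 - a * w.1.2) / s, (a * w.1.1 + b * w.1.2) / s),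
        ((b * w.2.1 - a * w.2.2) / s, (a * w.2.1 + b * w.2.2) / s))
      invFun := fun w => ((b * w.1.1 + a * w.1.2, -a * w.1.1 + b * w.1.2),
        (b * w.2.1 + a * w.2.2, -a * w.2.1 + b * w.2.2))
      map_add' := fun u v => by
        ext <;> simp only [Prod.fst_add, Prod.snd_add] <;> ring
      map_smul' := fun r u => by
        ext <;> simp only [Prod.smul_fst, Prod.smul_snd, smul_eq_mul, RingHom.id_apply] <;> ring
      left_inv := fun w => by
        ext <;> simp only <;> field_simp <;> ring
      right_inv := fun w => by
        ext <;> simp only <;> field_simp <;> ring }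
  have hΨ : ∀ w, Ψ w = (((b * w.1.1 - a * w.1.2) / s, (a * w.1.1 + b * w.1.2) / s),
        ((b * w.2.1 - a * w.2.2) / s, (a * w.2.1 + b * w.2.2) / s)) := fun w => rfl
  -- the three algebraic identities behind "similarity of ratio 1/√s"
  have e1 : ∀ p q : ℝ, ((b * p - a * q) / s) ^ 2 + ((a * p + b * q) / s) ^ 2 =
      (p ^ 2 + q ^ 2) / s := fun p q => by
    field_simp
    ring
  have e2 : ∀ p q : ℝ, ((b * p - a * q) / s) ^ 2 + ((a * p + b * q) / s - 1) ^ 2 =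
      ((a - p) ^ 2 + (b - q) ^ 2) / s := fun p q => by
    field_simp
    ring
  have e3 : ∀ p q p' q' : ℝ, ((b * p - a * q) / s - (b * p' - a * q') / s) ^ 2 +
      ((a * p + b * q) / s - (a * p' + b * q') / s) ^ 2 = ((p - p') ^ 2 + (q - q') ^ 2) / s :=
    fun p q p' q' => by
    field_simp
    ring
  have hpre : (Ψ : ((ℝ × ℝ) × (ℝ × ℝ)) → ((ℝ × ℝ) × (ℝ × ℝ))) ⁻¹'
      {w : (ℝ × ℝ) × (ℝ × ℝ) |
      w.1.1 ^ (2:ℕ) + w.1.2 ^ (2:ℕ) < 1 ∧ w.1.1 ^ (2:ℕ) + (w.1.2 - 1) ^ (2:ℕ) < 1 ∧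
      w.2.1 ^ (2:ℕ) + w.2.2 ^ (2:ℕ) < 1 ∧ w.2.1 ^ (2:ℕ) + (w.2.2 - 1) ^ (2:ℕ) < 1 ∧
      (w.1.1 - w.2.1) ^ (2:ℕ) + (w.1.2 - w.2.2) ^ (2:ℕ) < 1} =
      {w : (ℝ × ℝ) × (ℝ × ℝ) | w.1.1 ^ 2 + w.1.2 ^ 2 < s ∧ w.2.1 ^ 2 + w.2.2 ^ 2 < s ∧
        (a - w.1.1) ^ 2 + (b - w.1.2) ^ 2 < s ∧ (a - w.2.1) ^ 2 + (b - w.2.2) ^ 2 < s ∧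
        (w.1.1 - w.2.1) ^ 2 + (w.1.2 - w.2.2) ^ 2 < s} := by
    ext w
    simp only [mem_preimage, mem_setOf_eq, hΨ, e1, e2, e3, div_lt_one hx]
    tauto
  have hdisc : (Ψ : ((ℝ × ℝ) × (ℝ × ℝ)) → ((ℝ × ℝ) × (ℝ × ℝ))) ⁻¹'
      ({y : ℝ × ℝ | y.1 ^ 2 + y.2 ^ 2 < 1} ×ˢ {y : ℝ × ℝ | y.1 ^ 2 + y.2 ^ 2 < 1}) =
      {y : ℝ × ℝ | y.1 ^ 2 + y.2 ^ 2 < s} ×ˢ {y : ℝ × ℝ | y.1 ^ 2 + y.2 ^ 2 < s} := by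
    ext w
    simp only [mem_preimage, mem_prod, mem_setOf_eq, hΨ, e1, div_lt_one hx]
  -- the determinant factor is `s²`, read off from the discs
  have hdet : ENNReal.ofReal |LinearMap.det (Ψ.symm : ((ℝ × ℝ) × (ℝ × ℝ)) →ₗ[ℝ]
      ((ℝ × ℝ) × (ℝ × ℝ)))| = ENNReal.ofReal (s ^ 2) := by
    have key := Measure.addHaar_preimage_linearEquiv volume Ψ
      ({y : ℝ × ℝ | y.1 ^ 2 + y.2 ^ 2 < 1} ×ˢ {y : ℝ × ℝ | y.1 ^ 2 + y.2 ^ 2 < 1})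
    rw [hdisc, Measure.volume_eq_prod, Measure.prod_prod, Measure.prod_prod,
      volume_disc_sq_lt hx] at key
    have hne : volume {y : ℝ × ℝ | y.1 ^ 2 + y.2 ^ 2 < 1} *
        volume {y : ℝ × ℝ | y.1 ^ 2 + y.2 ^ 2 < 1} ≠ 0 :=
      mul_ne_zero volume_disc_ne_zero volume_disc_ne_zero
    have hnt : volume {y : ℝ × ℝ | y.1 ^ 2 + y.2 ^ 2 < 1} *
        volume {y : ℝ × ℝ | y.1 ^ 2 + y.2 ^ 2 < 1} ≠ ⊤ :=
      ENNReal.mul_ne_top volume_disc_ne_top volume_disc_ne_top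
    have key' : (ENNReal.ofReal s * ENNReal.ofReal s) *
        (volume {y : ℝ × ℝ | y.1 ^ 2 + y.2 ^ 2 < 1} *
          volume {y : ℝ × ℝ | y.1 ^ 2 + y.2 ^ 2 < 1}) =
        ENNReal.ofReal |LinearMap.det (Ψ.symm : ((ℝ × ℝ) × (ℝ × ℝ)) →ₗ[ℝ]
          ((ℝ × ℝ) × (ℝ × ℝ)))| *
        (volume {y : ℝ × ℝ | y.1 ^ 2 + y.2 ^ 2 < 1} *
          volume {y : ℝ × ℝ | y.1 ^ 2 + y.2 ^ 2 < 1}) := by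
      rw [← key]; ring
    rw [← (ENNReal.mul_left_inj hne hnt).mp key', ← ENNReal.ofReal_mul hx.le, sq]
  rw [← hpre, Measure.addHaar_preimage_linearEquiv, hdet]

/-- Volume of the `x`-slices of `P₁`: `|x|⁴ · vol(Wset)` for `|x| < 1`, else `0`. [folklore] -/
theorem volume_slice_P1 (x : ℝ × ℝ) :
    volume (Prod.mk x ⁻¹'
      {c : ((ℝ × ℝ) × ((ℝ × ℝ) × (ℝ × ℝ))) |
      c.1.1 ^ (2:ℕ) + c.1.2 ^ (2:ℕ) < 1 ∧
      c.2.1.1 ^ (2:ℕ) + c.2.1.2 ^ (2:ℕ) < c.1.1 ^ (2:ℕ) + c.1.2 ^ (2:ℕ) ∧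
      c.2.2.1 ^ (2:ℕ) + c.2.2.2 ^ (2:ℕ) < c.1.1 ^ (2:ℕ) + c.1.2 ^ (2:ℕ) ∧
      (c.1.1 - c.2.1.1) ^ (2:ℕ) + (c.1.2 - c.2.1.2) ^ (2:ℕ) < c.1.1 ^ (2:ℕ) + c.1.2 ^ (2:ℕ) ∧
      (c.1.1 - c.2.2.1) ^ (2:ℕ) + (c.1.2 - c.2.2.2) ^ (2:ℕ) < c.1.1 ^ (2:ℕ) + c.1.2 ^ (2:ℕ) ∧
      (c.2.1.1 - c.2.2.1) ^ (2:ℕ) + (c.2.1.2 - c.2.2.2) ^ (2:ℕ) <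
        c.1.1 ^ (2:ℕ) + c.1.2 ^ (2:ℕ)}) =
    if x.1 ^ 2 + x.2 ^ 2 < 1 ^ 2 then ENNReal.ofReal (√(x.1 ^ 2 + x.2 ^ 2) ^ 4) * volume
      {w : (ℝ × ℝ) × (ℝ × ℝ) |
      w.1.1 ^ (2:ℕ) + w.1.2 ^ (2:ℕ) < 1 ∧ w.1.1 ^ (2:ℕ) + (w.1.2 - 1) ^ (2:ℕ) < 1 ∧
      w.2.1 ^ (2:ℕ) + w.2.2 ^ (2:ℕ) < 1 ∧ w.2.1 ^ (2:ℕ) + (w.2.2 - 1) ^ (2:ℕ) < 1 ∧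
      (w.1.1 - w.2.1) ^ (2:ℕ) + (w.1.2 - w.2.2) ^ (2:ℕ) < 1}
    else 0 := by
  by_cases h1 : x.1 ^ 2 + x.2 ^ 2 < 1
  · have h1' : x.1 ^ 2 + x.2 ^ 2 < 1 ^ 2 := by rwa [one_pow]
    rw [if_pos h1']
    have hpre : Prod.mk x ⁻¹'
        {c : ((ℝ × ℝ) × ((ℝ × ℝ) × (ℝ × ℝ))) |
      c.1.1 ^ (2:ℕ) + c.1.2 ^ (2:ℕ) < 1 ∧
      c.2.1.1 ^ (2:ℕ) + c.2.1.2 ^ (2:ℕ) < c.1.1 ^ (2:ℕ) + c.1.2 ^ (2:ℕ) ∧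
      c.2.2.1 ^ (2:ℕ) + c.2.2.2 ^ (2:ℕ) < c.1.1 ^ (2:ℕ) + c.1.2 ^ (2:ℕ) ∧
      (c.1.1 - c.2.1.1) ^ (2:ℕ) + (c.1.2 - c.2.1.2) ^ (2:ℕ) < c.1.1 ^ (2:ℕ) + c.1.2 ^ (2:ℕ) ∧
      (c.1.1 - c.2.2.1) ^ (2:ℕ) + (c.1.2 - c.2.2.2) ^ (2:ℕ) < c.1.1 ^ (2:ℕ) + c.1.2 ^ (2:ℕ) ∧
      (c.2.1.1 - c.2.2.1) ^ (2:ℕ) + (c.2.1.2 - c.2.2.2) ^ (2:ℕ) <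
        c.1.1 ^ (2:ℕ) + c.1.2 ^ (2:ℕ)} =
        {w : (ℝ × ℝ) × (ℝ × ℝ) | w.1.1 ^ 2 + w.1.2 ^ 2 < x.1 ^ 2 + x.2 ^ 2 ∧
        w.2.1 ^ 2 + w.2.2 ^ 2 < x.1 ^ 2 + x.2 ^ 2 ∧
        (x.1 - w.1.1) ^ 2 + (x.2 - w.1.2) ^ 2 < x.1 ^ 2 + x.2 ^ 2 ∧
        (x.1 - w.2.1) ^ 2 + (x.2 - w.2.2) ^ 2 < x.1 ^ 2 + x.2 ^ 2 ∧
        (w.1.1 - w.2.1) ^ 2 + (w.1.2 - w.2.2) ^ 2 < x.1 ^ 2 + x.2 ^ 2} := by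
      ext w
      simp only [mem_preimage, mem_setOf_eq]
      tauto
    rw [hpre]
    rcases (show (0:ℝ) ≤ x.1 ^ 2 + x.2 ^ 2 by positivity).eq_or_lt with h0 | h0
    · -- `x = 0`: the slice is empty
      have : {w : (ℝ × ℝ) × (ℝ × ℝ) | w.1.1 ^ 2 + w.1.2 ^ 2 < x.1 ^ 2 + x.2 ^ 2 ∧
        w.2.1 ^ 2 + w.2.2 ^ 2 < x.1 ^ 2 + x.2 ^ 2 ∧
        (x.1 - w.1.1) ^ 2 + (x.2 - w.1.2) ^ 2 < x.1 ^ 2 + x.2 ^ 2 ∧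
        (x.1 - w.2.1) ^ 2 + (x.2 - w.2.2) ^ 2 < x.1 ^ 2 + x.2 ^ 2 ∧
        (w.1.1 - w.2.1) ^ 2 + (w.1.2 - w.2.2) ^ 2 < x.1 ^ 2 + x.2 ^ 2} = ∅ := by
        ext w
        simp only [mem_setOf_eq, mem_empty_iff_false, iff_false, not_and]
        intro hw
        nlinarith [sq_nonneg w.1.1, sq_nonneg w.1.2]
      rw [this, measure_empty, ← h0]
      simp
    · rw [volume_slice_pos x h0]
      congr 2
      rw [show (4:ℕ) = 2 * 2 by norm_num, pow_mul, sq_sqrt h0.le]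
  · have h1' : ¬ x.1 ^ 2 + x.2 ^ 2 < 1 ^ 2 := by rwa [one_pow]
    rw [if_neg h1']
    have : Prod.mk x ⁻¹'
        {c : ((ℝ × ℝ) × ((ℝ × ℝ) × (ℝ × ℝ))) |
      c.1.1 ^ (2:ℕ) + c.1.2 ^ (2:ℕ) < 1 ∧
      c.2.1.1 ^ (2:ℕ) + c.2.1.2 ^ (2:ℕ) < c.1.1 ^ (2:ℕ) + c.1.2 ^ (2:ℕ) ∧
      c.2.2.1 ^ (2:ℕ) + c.2.2.2 ^ (2:ℕ) < c.1.1 ^ (2:ℕ) + c.1.2 ^ (2:ℕ) ∧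
      (c.1.1 - c.2.1.1) ^ (2:ℕ) + (c.1.2 - c.2.1.2) ^ (2:ℕ) < c.1.1 ^ (2:ℕ) + c.1.2 ^ (2:ℕ) ∧
      (c.1.1 - c.2.2.1) ^ (2:ℕ) + (c.1.2 - c.2.2.2) ^ (2:ℕ) < c.1.1 ^ (2:ℕ) + c.1.2 ^ (2:ℕ) ∧
      (c.2.1.1 - c.2.2.1) ^ (2:ℕ) + (c.2.1.2 - c.2.2.2) ^ (2:ℕ) <
        c.1.1 ^ (2:ℕ) + c.1.2 ^ (2:ℕ)} = ∅ := by
      ext w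
      simp only [mem_preimage, mem_setOf_eq, mem_empty_iff_false, iff_false, not_and]
      intro h
      exact absurd h h1
    rw [this, measure_empty]

/-- `vol(P₁) = (π/3) · vol(Wset)` (Tonelli over `x`, then polar coordinates:
`∫_{|x|<1} |x|⁴ dx = 2π/6`). [folklore] -/
theorem volume_P1 :
    volume {c : ((ℝ × ℝ) × ((ℝ × ℝ) × (ℝ × ℝ))) |
      c.1.1 ^ (2:ℕ) + c.1.2 ^ (2:ℕ) < 1 ∧
      c.2.1.1 ^ (2:ℕ) + c.2.1.2 ^ (2:ℕ) < c.1.1 ^ (2:ℕ) + c.1.2 ^ (2:ℕ) ∧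
      c.2.2.1 ^ (2:ℕ) + c.2.2.2 ^ (2:ℕ) < c.1.1 ^ (2:ℕ) + c.1.2 ^ (2:ℕ) ∧
      (c.1.1 - c.2.1.1) ^ (2:ℕ) + (c.1.2 - c.2.1.2) ^ (2:ℕ) < c.1.1 ^ (2:ℕ) + c.1.2 ^ (2:ℕ) ∧
      (c.1.1 - c.2.2.1) ^ (2:ℕ) + (c.1.2 - c.2.2.2) ^ (2:ℕ) < c.1.1 ^ (2:ℕ) + c.1.2 ^ (2:ℕ) ∧
      (c.2.1.1 - c.2.2.1) ^ (2:ℕ) + (c.2.1.2 - c.2.2.2) ^ (2:ℕ) <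
        c.1.1 ^ (2:ℕ) + c.1.2 ^ (2:ℕ)} =
    ENNReal.ofReal (π / 3) * volume
      {w : (ℝ × ℝ) × (ℝ × ℝ) |
      w.1.1 ^ (2:ℕ) + w.1.2 ^ (2:ℕ) < 1 ∧ w.1.1 ^ (2:ℕ) + (w.1.2 - 1) ^ (2:ℕ) < 1 ∧
      w.2.1 ^ (2:ℕ) + w.2.2 ^ (2:ℕ) < 1 ∧ w.2.1 ^ (2:ℕ) + (w.2.2 - 1) ^ (2:ℕ) < 1 ∧
      (w.1.1 - w.2.1) ^ (2:ℕ) + (w.1.2 - w.2.2) ^ (2:ℕ) < 1} := by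
  rw [Measure.volume_eq_prod, Measure.prod_apply measurableSet_P1]
  simp only [volume_slice_P1]
  have hmeas : Measurable fun x : ℝ × ℝ => if x.1 ^ 2 + x.2 ^ 2 < 1 ^ 2 then
      ENNReal.ofReal (√(x.1 ^ 2 + x.2 ^ 2) ^ 4) else 0 :=
    Measurable.ite (measurableSet_lt (by fun_prop) (by fun_prop))
      (ENNReal.continuous_ofReal.comp (by fun_prop)).measurable measurable_const
  have heq : ∀ x : ℝ × ℝ, (if x.1 ^ 2 + x.2 ^ 2 < 1 ^ 2 then
      ENNReal.ofReal (√(x.1 ^ 2 + x.2 ^ 2) ^ 4) * volume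
      {w : (ℝ × ℝ) × (ℝ × ℝ) |
      w.1.1 ^ (2:ℕ) + w.1.2 ^ (2:ℕ) < 1 ∧ w.1.1 ^ (2:ℕ) + (w.1.2 - 1) ^ (2:ℕ) < 1 ∧
      w.2.1 ^ (2:ℕ) + w.2.2 ^ (2:ℕ) < 1 ∧ w.2.1 ^ (2:ℕ) + (w.2.2 - 1) ^ (2:ℕ) < 1 ∧
      (w.1.1 - w.2.1) ^ (2:ℕ) + (w.1.2 - w.2.2) ^ (2:ℕ) < 1}
      else 0) =
      (if x.1 ^ 2 + x.2 ^ 2 < 1 ^ 2 then ENNReal.ofReal (√(x.1 ^ 2 + x.2 ^ 2) ^ 4) else 0) *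
      volume
      {w : (ℝ × ℝ) × (ℝ × ℝ) |
      w.1.1 ^ (2:ℕ) + w.1.2 ^ (2:ℕ) < 1 ∧ w.1.1 ^ (2:ℕ) + (w.1.2 - 1) ^ (2:ℕ) < 1 ∧
      w.2.1 ^ (2:ℕ) + w.2.2 ^ (2:ℕ) < 1 ∧ w.2.1 ^ (2:ℕ) + (w.2.2 - 1) ^ (2:ℕ) < 1 ∧
      (w.1.1 - w.2.1) ^ (2:ℕ) + (w.1.2 - w.2.2) ^ (2:ℕ) < 1} := by
    intro x
    split_ifs <;> simp
  simp only [heq]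
  rw [lintegral_mul_const _ hmeas,
    lintegral_radial_ite (c := 1) (f := fun ρ => ρ ^ 4) one_pos (by fun_prop)
      (fun r _ => by positivity)]
  have hint : ∫ r in (0:ℝ)..1, r * r ^ 4 = 1 / 6 := by
    rw [show (fun r : ℝ => r * r ^ 4) = fun r => r ^ 5 by funext r; ring, integral_pow]
    norm_num
  rw [hint, ← ENNReal.ofReal_mul (by positivity)]
  congr 1
  congr 1
  ring

/-- **The complete star in product coordinates**: `vol(star) = 2π · vol(Wset)`. [folklore] -/
theorem volume_starProd :
    volume {c : ((ℝ × ℝ) × ((ℝ × ℝ) × (ℝ × ℝ))) |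
      c.1.1 ^ (2:ℕ) + c.1.2 ^ (2:ℕ) < 1 ∧
      c.2.1.1 ^ (2:ℕ) + c.2.1.2 ^ (2:ℕ) < 1 ∧
      c.2.2.1 ^ (2:ℕ) + c.2.2.2 ^ (2:ℕ) < 1 ∧
      (c.1.1 - c.2.1.1) ^ (2:ℕ) + (c.1.2 - c.2.1.2) ^ (2:ℕ) < 1 ∧
      (c.1.1 - c.2.2.1) ^ (2:ℕ) + (c.1.2 - c.2.2.2) ^ (2:ℕ) < 1 ∧
      (c.2.1.1 - c.2.2.1) ^ (2:ℕ) + (c.2.1.2 - c.2.2.2) ^ (2:ℕ) < 1} =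
    ENNReal.ofReal (2 * π) * volume
      {w : (ℝ × ℝ) × (ℝ × ℝ) |
      w.1.1 ^ (2:ℕ) + w.1.2 ^ (2:ℕ) < 1 ∧ w.1.1 ^ (2:ℕ) + (w.1.2 - 1) ^ (2:ℕ) < 1 ∧
      w.2.1 ^ (2:ℕ) + w.2.2 ^ (2:ℕ) < 1 ∧ w.2.1 ^ (2:ℕ) + (w.2.2 - 1) ^ (2:ℕ) < 1 ∧
      (w.1.1 - w.2.1) ^ (2:ℕ) + (w.1.2 - w.2.2) ^ (2:ℕ) < 1} := by
  rw [volume_star_eq, volume_P1, ← mul_assoc]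
  congr 1
  rw [show (6 : ENNReal) = ENNReal.ofReal 6 by norm_num, ← ENNReal.ofReal_mul (by norm_num)]
  congr 1
  ring

/-- `starDisc` is measurable. [folklore] -/
theorem measurableSet_starDisc : MeasurableSet HardSphereVirial.starDisc := by
  simp only [HardSphereVirial.starDisc, setOf_and]
  refine MeasurableSet.inter ?_ (MeasurableSet.inter ?_ (MeasurableSet.inter ?_
    (MeasurableSet.inter ?_ (MeasurableSet.inter ?_ ?_)))) <;>
    exact measurableSet_lt (by fun_prop) (by fun_prop)

/-- **The complete star of hard discs**: `vol(starDisc) = 2π · vol(Wset)` (transport along the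
coordinate map `(p, (a, b)) ↦ ![a₁, a₂, p₁, p₂, b₁, b₂]`, under which `x₃ = p` plays the role of
the distinguished point `x`). [folklore] -/
theorem volume_starDisc_eq :
    volume HardSphereVirial.starDisc = ENNReal.ofReal (2 * π) * volume
      {w : (ℝ × ℝ) × (ℝ × ℝ) |
      w.1.1 ^ (2:ℕ) + w.1.2 ^ (2:ℕ) < 1 ∧ w.1.1 ^ (2:ℕ) + (w.1.2 - 1) ^ (2:ℕ) < 1 ∧
      w.2.1 ^ (2:ℕ) + w.2.2 ^ (2:ℕ) < 1 ∧ w.2.1 ^ (2:ℕ) + (w.2.2 - 1) ^ (2:ℕ) < 1 ∧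
      (w.1.1 - w.2.1) ^ (2:ℕ) + (w.1.2 - w.2.2) ^ (2:ℕ) < 1} := by
  have hpre : (fun c : ((ℝ × ℝ) × ((ℝ × ℝ) × (ℝ × ℝ))) =>
      (![c.2.1.1, c.2.1.2, c.1.1, c.1.2, c.2.2.1, c.2.2.2] : Fin 6 → ℝ)) ⁻¹'
      HardSphereVirial.starDisc =
      {c : ((ℝ × ℝ) × ((ℝ × ℝ) × (ℝ × ℝ))) |
      c.1.1 ^ (2:ℕ) + c.1.2 ^ (2:ℕ) < 1 ∧
      c.2.1.1 ^ (2:ℕ) + c.2.1.2 ^ (2:ℕ) < 1 ∧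
      c.2.2.1 ^ (2:ℕ) + c.2.2.2 ^ (2:ℕ) < 1 ∧
      (c.1.1 - c.2.1.1) ^ (2:ℕ) + (c.1.2 - c.2.1.2) ^ (2:ℕ) < 1 ∧
      (c.1.1 - c.2.2.1) ^ (2:ℕ) + (c.1.2 - c.2.2.2) ^ (2:ℕ) < 1 ∧
      (c.2.1.1 - c.2.2.1) ^ (2:ℕ) + (c.2.1.2 - c.2.2.2) ^ (2:ℕ) < 1} := by
    ext c
    simp only [HardSphereVirial.starDisc, mem_preimage, mem_setOf_eq, Matrix.cons_val_zero,
      Matrix.cons_val_one, Matrix.cons_val]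
    ring_nf
    tauto
  rw [← measurePreserving_toFin6.measure_preimage measurableSet_starDisc.nullMeasurableSet, hpre,
    volume_starProd]

end HardDiscStarVolume

end Literature.MathematicalPhysics.StatisticalMechanics

end
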